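import Summits.Ventures.PercRepro.OrbitK

/-!
# PercRepro — S2: THE EXACT CONSTANT `Φ(15, 5)` (p7, gen 11)

`Φ(15, 5) = Σ_{5<u<15} C(20, u) / C(20, 15) = (2^20 − 2·21700)/15504 = 1005176/15504 = 389/6 = 64.8333…`, against the
kit's `2^20/C(20, 5) = 67.63…` (`phiK_le_two_pow_div`): the cell arithmetic of the `p = 15` row of the `q = 5` window
may use the exact value (`−4.1 %` on the `U`-term; `K = ⌊2^20/Φ⌋ = 16173` in place of `C(20, 5) = 15504`). Axioms: standard.
-/

namespace PercRepro

namespace S2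

/-- `Φ(15, 5) = 389 / 6` exactly. -/
theorem phiK_fifteen_five : phiK 15 5 = 389 / 6 := by
  unfold phiK
  rw [show Finset.Ioo 5 15 = Finset.Icc 6 14 from rfl]
  simp only [Finset.sum_Icc_succ_top (show 6 ≤ 14 by norm_num), Finset.sum_Icc_succ_top (show 6 ≤ 13 by norm_num),
    Finset.sum_Icc_succ_top (show 6 ≤ 12 by norm_num), Finset.sum_Icc_succ_top (show 6 ≤ 11 by norm_num),
    Finset.sum_Icc_succ_top (show 6 ≤ 10 by norm_num), Finset.sum_Icc_succ_top (show 6 ≤ 9 by norm_num),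
    Finset.sum_Icc_succ_top (show 6 ≤ 8 by norm_num), Finset.sum_Icc_succ_top (show 6 ≤ 7 by norm_num),
    Finset.Icc_self, Finset.sum_singleton]
  norm_num [Nat.choose]

/-- The exact constant against `K = 16173`: `Φ(15, 5) ≤ 2^20 / 16173` (and `16173` is the largest such `K`). -/
theorem phiK_fifteen_five_le : phiK 15 5 ≤ 2 ^ 20 / 16173 := by
  rw [phiK_fifteen_five]; norm_num

end S2

end PercRepro
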